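import Summits.CriticalPhenomena.SAWScalingLimit.Theses.SAWStressTensor
import Summits.CriticalPhenomena.SAWScalingLimit.Theorems.SAWRenewalTightnessTightIdentificationGlue

/-!
# Route `SAWStressTensor`: the assembly frame (stmt-CriticalPhenomena-7754)

Item `stmt-CriticalPhenomena-7754` of route `SAWStressTensor` (sub-problem `SAWScalingLimit`):

  `Assembly : QuadrupoleShape → SlitQuadrupoleShape → SimpleSubseqLimits →
    QuadrupoleIdentification → EventualTight → SAWScalingLimit`.

`QuadrupoleIdentification` is, by definition, `SlitQuadrupoleShape → SimpleSubseqLimits →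
SubseqIdentification` with the last two decls inlined verbatim, so applying it to the two
hypotheses identifies every subsequential weak limit of the critical SAW laws along a mesh
sequence `s_n → 0⁺` (a probability measure on `CurveClass ℂ`) as the chordal SLE_{8/3} law of
`(D; a, b)`. Together with `EventualTight` (tightness along the mesh, `IsTightAlongMesh`) the
PROVED SAW instance of the Prokhorov/Billingsley convergence criterion,
`saw_convergesInLawToSLE_of_isTightAlongMesh` (file
`SAWRenewalTightnessTightIdentificationGlue.lean`: the critical SAW laws are probability measures
for all small `δ`, the curve observable is measurable, Prokhorov on the Polish space
`CurveClass ℂ`, subsequence principle along `𝓝[>] 0`, uniqueness of the SLE_{8/3} law), gives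
`ConvergesInLawToSLE (8/3) D …` for every Dobrushin domain and endpoint approximation, i.e. the
conjunct `SAWScalingLimit`. The headline crux `QuadrupoleShape` (the prefix-free case of
`SlitQuadrupoleShape`) is carried as a hypothesis and not used by the soft tail. Same logical
shape as the accepted assemblies of routes `SAWParafermion` / `SAWRenewalTightness`
(`tightIdentificationGlue_parafermion_proof`).

## References

* P. Billingsley, *Convergence of Probability Measures*, 2nd ed. (1999), Thm. 5.1 and its
  Corollary [BillingsleyCPM1999].
* G. F. Lawler, O. Schramm, W. Werner, *On the scaling limit of planar self-avoiding walk*, Proc.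
  Sympos. Pure Math. 72 (2004), §3.4.2 and §4.1, Prediction 1 [LawlerSchrammWerner2004SAW].
-/

noncomputable section

open MeasureTheory Filter Topology
open scoped NNReal
open Literature.Probability.RandomPlanarGeometry Literature.Probability.LatticeModels

namespace Summit.CriticalPhenomena.SAWScalingLimit.Theorems

open Summit.CriticalPhenomena.SAWScalingLimit.Theses.SAWStressTensor in
/-- **Item `stmt-CriticalPhenomena-7754` (`SAWStressTensor.Assembly`):
`QuadrupoleShape → SlitQuadrupoleShape → SimpleSubseqLimits → QuadrupoleIdentification →
EventualTight → SAWScalingLimit`.** `QuadrupoleIdentification` applied to `SlitQuadrupoleShape`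
and `SimpleSubseqLimits` is the identification of subsequential limits (`SubseqIdentification`,
inlined verbatim in the def); for each `(D, a, b)` with `IsEndpointApprox`, tightness along the
mesh (`EventualTight`) and that identification, read through `IsSubseqLimitLaw`, feed
`saw_convergesInLawToSLE_of_isTightAlongMesh`, whose conclusion is the `(D, a, b)`-instance of
`SAWScalingLimit`. `QuadrupoleShape` is carried, unused, as the headline hypothesis.
[cite: BillingsleyCPM1999, Thm. 5.1, Corollary] -/
theorem stressTensor_assembly_proof :
    Summit.CriticalPhenomena.SAWScalingLimit.Theses.SAWStressTensor.Assembly := by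
  unfold Summit.CriticalPhenomena.SAWScalingLimit.Theses.SAWStressTensor.Assembly
  intro _hQ hSlit hSimple hQI hT D a b hab
  have hI := hQI hSlit hSimple
  refine saw_convergesInLawToSLE_of_isTightAlongMesh hab (hT D a b hab) ?_
  rintro μ hμ ⟨s, hs, hlim⟩
  exact hI D a b hab s μ hs hμ hlim

end Summit.CriticalPhenomena.SAWScalingLimit.Theorems

end
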